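import Summits.MatrixMultiplication.OmegaCensus.Z4Z4DominoUniformSums
import HarnessLib

/-!
# The uniform domino theorem: no shifted domino form of ANY size over `A ↠ ℤ₄ × ℤ₄`

ω-census `pub-omega`, family (b3), seat pub-omega-group gen 16.  Framing: lottery ticket; floor = certified bounds/negative
ranges.  VALUE: a kernel theorem about the group-theoretic method (TPP capacity of dihedral-like groups) closing the whole
`ℤ₄²`-quotient column of the domino cells of the Dih classification, for every part size at once; NOT progress on ω.

**Theorem (`no_shifted_form_of_onto_z4z4`).** Let `A` be a finite abelian group with a surjection `φ : A →+ ZMod 4 × ZMod 4`.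
There are no `X, Y ⊆ A`, `β, γ, x₀ ∈ A` with `X + Y` direct and `(X+Y) ⊔ (β + (Y−X)) ⊔ (γ + (X−Y)) = A ∖ {x₀}` — for ANY sizes
`|X|, |Y|`.  (Gens 14–16 proved `|X| ∈ {3, 5, 7, 9}` by finite tables; this supersedes them.)  Consequently (file
`DominoUniformZ4Z4Cells.lean`) no TPP triple with coset parts `(1,1 | d,d | e,e)` in any dihedral-like group over such `A`
attains `3|S||T||U| + 8 = 8|A|`, for all `d, e`.

*Proof.*  For every pulled-back character `ψ`, `a b + ψ(β) ā b + ψ(γ) a b̄ = −ψ(x₀)` (`a = ψ(X)`, `b = ψ(Y)`).  The real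
characters forbid `ψ(β) = ψ(γ) = 1`, so there are coordinates `w, w'` dual to `(φβ, φγ)`; write `m, n` for the coordinates of a
point of `X` and `c_ee, c_eo, c_oe, c_oo` for the numbers of points of `X` in the four parity classes.  (i) The three real
characters give `c_ee + c_eo − c_oe − c_oo = ±1` and its two analogues (an integer times something is a unit).  (ii) For the
characters `w, w + 2w'` (`ψβ = i`, `ψγ = ±1`) and `w', w' + 2w` (`ψβ = ±1`, `ψγ = i`) the Pell lemmas `kP_mod_four`,
`kPp_mod_four`, `kPm_mod_four` (`Z4Z4DominoUniformKit.lean`: the identity forces `gcd(Re a, Im a) = 1` and `D ∣ Re a, Im a`,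
so `D = ±1`, a Pell equation read mod `8`) pin the even coordinate of each of the four sums `a` modulo `4`.  (iii) The sums
`a_w ± a_{w+2w'}`, `a_{w'} ± a_{w'+2w}` are `≡ 2·(class count) (mod 4)` coordinatewise (`reim_L1`–`reim_L8`).  The resulting
linear system in the eight coordinates and four class counts has no solution (`omega`; by hand: the class counts are three
of one parity and one of the other, and the two cases are killed by the two pairs respectively).  ∎
-/

namespace Summit.MatrixMultiplication.OmegaCensus

open Finset

/-! ## Summed congruences and real-character sums -/

section Sums

variable {α : Type*} (s : Finset α) (m n : α → ZMod 4)

/-- Conversion `(z : ZMod 4) = 2·c ⇒ z % 4 = 2c % 4`. [folklore] -/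
theorem emod4_of_cast_eq {z : ℤ} {c : ℕ} (h : (z : ZMod 4) = (c : ZMod 4) * 2) : z % 4 = 2 * (c : ℤ) % 4 := by
  have h' : (z : ZMod 4) = ((2 * (c : ℤ) : ℤ) : ZMod 4) := by rw [h]; push_cast; ring
  rw [ZMod.intCast_eq_intCast_iff'] at h'
  norm_num at h'
  omega

/-- `Re a_w + Re a_{w+2w'} ≡ 2 c_ee (mod 4)`. [folklore] -/
theorem congr_L1 : ((∑ x ∈ s, (⟨0, 1⟩ : GaussianInt) ^ (m x).val).re +
    (∑ x ∈ s, (⟨0, 1⟩ : GaussianInt) ^ (m x + 2 * n x).val).re) % 4 =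
    2 * ((s.filter fun x => 2 * m x = 0 ∧ 2 * n x = 0).card : ℤ) % 4 := by
  apply emod4_of_cast_eq
  rw [← Zsqrtd.re_add, ← sum_add_distrib, gi_re_sum, Int.cast_sum, sum_congr rfl fun x _ => reim_L1 (m x) (n x),
    sum_ite, sum_const, sum_const_zero, add_zero, nsmul_eq_mul]

/-- `Im a_w + Im a_{w+2w'} ≡ 2 c_oe (mod 4)`. [folklore] -/
theorem congr_L2 : ((∑ x ∈ s, (⟨0, 1⟩ : GaussianInt) ^ (m x).val).im +
    (∑ x ∈ s, (⟨0, 1⟩ : GaussianInt) ^ (m x + 2 * n x).val).im) % 4 =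
    2 * ((s.filter fun x => 2 * m x = 2 ∧ 2 * n x = 0).card : ℤ) % 4 := by
  apply emod4_of_cast_eq
  rw [← Zsqrtd.im_add, ← sum_add_distrib, gi_im_sum, Int.cast_sum, sum_congr rfl fun x _ => reim_L2 (m x) (n x),
    sum_ite, sum_const, sum_const_zero, add_zero, nsmul_eq_mul]

/-- `Re a_w − Re a_{w+2w'} ≡ 2 c_eo (mod 4)`. [folklore] -/
theorem congr_L3 : ((∑ x ∈ s, (⟨0, 1⟩ : GaussianInt) ^ (m x).val).re -
    (∑ x ∈ s, (⟨0, 1⟩ : GaussianInt) ^ (m x + 2 * n x).val).re) % 4 =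
    2 * ((s.filter fun x => 2 * m x = 0 ∧ 2 * n x = 2).card : ℤ) % 4 := by
  apply emod4_of_cast_eq
  rw [← Zsqrtd.re_sub, ← sum_sub_distrib, gi_re_sum, Int.cast_sum, sum_congr rfl fun x _ => reim_L3 (m x) (n x),
    sum_ite, sum_const, sum_const_zero, add_zero, nsmul_eq_mul]

/-- `Im a_w − Im a_{w+2w'} ≡ 2 c_oo (mod 4)`. [folklore] -/
theorem congr_L4 : ((∑ x ∈ s, (⟨0, 1⟩ : GaussianInt) ^ (m x).val).im -
    (∑ x ∈ s, (⟨0, 1⟩ : GaussianInt) ^ (m x + 2 * n x).val).im) % 4 =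
    2 * ((s.filter fun x => 2 * m x = 2 ∧ 2 * n x = 2).card : ℤ) % 4 := by
  apply emod4_of_cast_eq
  rw [← Zsqrtd.im_sub, ← sum_sub_distrib, gi_im_sum, Int.cast_sum, sum_congr rfl fun x _ => reim_L4 (m x) (n x),
    sum_ite, sum_const, sum_const_zero, add_zero, nsmul_eq_mul]

/-- `Re a_{w'} + Re a_{w'+2w} ≡ 2 c_ee (mod 4)`. [folklore] -/
theorem congr_L5 : ((∑ x ∈ s, (⟨0, 1⟩ : GaussianInt) ^ (n x).val).re +
    (∑ x ∈ s, (⟨0, 1⟩ : GaussianInt) ^ (n x + 2 * m x).val).re) % 4 =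
    2 * ((s.filter fun x => 2 * m x = 0 ∧ 2 * n x = 0).card : ℤ) % 4 := by
  apply emod4_of_cast_eq
  rw [← Zsqrtd.re_add, ← sum_add_distrib, gi_re_sum, Int.cast_sum, sum_congr rfl fun x _ => reim_L5 (m x) (n x),
    sum_ite, sum_const, sum_const_zero, add_zero, nsmul_eq_mul]

/-- `Im a_{w'} + Im a_{w'+2w} ≡ 2 c_eo (mod 4)`. [folklore] -/
theorem congr_L6 : ((∑ x ∈ s, (⟨0, 1⟩ : GaussianInt) ^ (n x).val).im +
    (∑ x ∈ s, (⟨0, 1⟩ : GaussianInt) ^ (n x + 2 * m x).val).im) % 4 =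
    2 * ((s.filter fun x => 2 * m x = 0 ∧ 2 * n x = 2).card : ℤ) % 4 := by
  apply emod4_of_cast_eq
  rw [← Zsqrtd.im_add, ← sum_add_distrib, gi_im_sum, Int.cast_sum, sum_congr rfl fun x _ => reim_L6 (m x) (n x),
    sum_ite, sum_const, sum_const_zero, add_zero, nsmul_eq_mul]

/-- `Re a_{w'} − Re a_{w'+2w} ≡ 2 c_oe (mod 4)`. [folklore] -/
theorem congr_L7 : ((∑ x ∈ s, (⟨0, 1⟩ : GaussianInt) ^ (n x).val).re -
    (∑ x ∈ s, (⟨0, 1⟩ : GaussianInt) ^ (n x + 2 * m x).val).re) % 4 =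
    2 * ((s.filter fun x => 2 * m x = 2 ∧ 2 * n x = 0).card : ℤ) % 4 := by
  apply emod4_of_cast_eq
  rw [← Zsqrtd.re_sub, ← sum_sub_distrib, gi_re_sum, Int.cast_sum, sum_congr rfl fun x _ => reim_L7 (m x) (n x),
    sum_ite, sum_const, sum_const_zero, add_zero, nsmul_eq_mul]

/-- `Im a_{w'} − Im a_{w'+2w} ≡ 2 c_oo (mod 4)`. [folklore] -/
theorem congr_L8 : ((∑ x ∈ s, (⟨0, 1⟩ : GaussianInt) ^ (n x).val).im -
    (∑ x ∈ s, (⟨0, 1⟩ : GaussianInt) ^ (n x + 2 * m x).val).im) % 4 =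
    2 * ((s.filter fun x => 2 * m x = 2 ∧ 2 * n x = 2).card : ℤ) % 4 := by
  apply emod4_of_cast_eq
  rw [← Zsqrtd.im_sub, ← sum_sub_distrib, gi_im_sum, Int.cast_sum, sum_congr rfl fun x _ => reim_L8 (m x) (n x),
    sum_ite, sum_const, sum_const_zero, add_zero, nsmul_eq_mul]

/-- The real character `2w` summed over `s`: `c_ee + c_eo − c_oe − c_oo`. [folklore] -/
theorem real_R1 : ∑ x ∈ s, (⟨0, 1⟩ : GaussianInt) ^ (2 * m x).val =
    ((((s.filter fun x => 2 * m x = 0 ∧ 2 * n x = 0).card : ℤ) + (s.filter fun x => 2 * m x = 0 ∧ 2 * n x = 2).card -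
      (s.filter fun x => 2 * m x = 2 ∧ 2 * n x = 0).card - (s.filter fun x => 2 * m x = 2 ∧ 2 * n x = 2).card : ℤ) :
      GaussianInt) := by
  apply Zsqrtd.ext
  · rw [gi_re_sum, sum_congr rfl fun x _ => re_R1 (m x) (n x), sum_sub_distrib, sum_sub_distrib, sum_add_distrib,
      sum_boole, sum_boole, sum_boole, sum_boole, Zsqrtd.re_intCast]
  · rw [gi_im_sum, sum_congr rfl fun x _ => ipow_two_mul_im (m x), sum_const_zero, Zsqrtd.im_intCast]

/-- The real character `2w'` summed over `s`: `c_ee − c_eo + c_oe − c_oo`. [folklore] -/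
theorem real_R2 : ∑ x ∈ s, (⟨0, 1⟩ : GaussianInt) ^ (2 * n x).val =
    ((((s.filter fun x => 2 * m x = 0 ∧ 2 * n x = 0).card : ℤ) - (s.filter fun x => 2 * m x = 0 ∧ 2 * n x = 2).card +
      (s.filter fun x => 2 * m x = 2 ∧ 2 * n x = 0).card - (s.filter fun x => 2 * m x = 2 ∧ 2 * n x = 2).card : ℤ) :
      GaussianInt) := by
  apply Zsqrtd.ext
  · rw [gi_re_sum, sum_congr rfl fun x _ => re_R2 (m x) (n x), sum_sub_distrib, sum_add_distrib, sum_sub_distrib,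
      sum_boole, sum_boole, sum_boole, sum_boole, Zsqrtd.re_intCast]
  · rw [gi_im_sum, sum_congr rfl fun x _ => ipow_two_mul_im (n x), sum_const_zero, Zsqrtd.im_intCast]

/-- The real character `2(w+w')` summed over `s`: `c_ee − c_eo − c_oe + c_oo`. [folklore] -/
theorem real_R3 : ∑ x ∈ s, (⟨0, 1⟩ : GaussianInt) ^ (2 * (m x + n x)).val =
    ((((s.filter fun x => 2 * m x = 0 ∧ 2 * n x = 0).card : ℤ) - (s.filter fun x => 2 * m x = 0 ∧ 2 * n x = 2).card -
      (s.filter fun x => 2 * m x = 2 ∧ 2 * n x = 0).card + (s.filter fun x => 2 * m x = 2 ∧ 2 * n x = 2).card : ℤ) :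
      GaussianInt) := by
  apply Zsqrtd.ext
  · rw [gi_re_sum, sum_congr rfl fun x _ => re_R3 (m x) (n x), sum_add_distrib, sum_sub_distrib, sum_sub_distrib,
      sum_boole, sum_boole, sum_boole, sum_boole, Zsqrtd.re_intCast]
  · rw [gi_im_sum, sum_congr rfl fun x _ => ipow_two_mul_im (m x + n x), sum_const_zero, Zsqrtd.im_intCast]

end Sums

/-! ## The uniform theorem -/

section Main

variable {A : Type*} [AddCommGroup A] [Fintype A] [DecidableEq A]

/-- **Uniform theorem.**  `A ↠ ZMod 4 × ZMod 4`; `X, Y, β, γ, x₀` with `X + Y` direct and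
`(X+Y) ⊔ (β + (Y−X)) ⊔ (γ + (X−Y)) = A ∖ {x₀}` — for any sizes.  Then `False`. [folklore] -/
theorem no_shifted_form_of_onto_z4z4 (φ : A →+ ZMod 4 × ZMod 4) (hφ : Function.Surjective φ)
    {X Y : Finset A} {β γ x₀ : A}
    (hinj : Set.InjOn (fun p : A × A => p.1 + p.2) ↑(X ×ˢ Y))
    (hPQ : Disjoint ((X ×ˢ Y).image fun p : A × A => p.1 + p.2)
      (((Y ×ˢ X).image fun p : A × A => p.1 - p.2).image fun z => z + β))
    (hPR : Disjoint ((X ×ˢ Y).image fun p : A × A => p.1 + p.2)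
      (((X ×ˢ Y).image fun p : A × A => p.1 - p.2).image fun z => z + γ))
    (hQR : Disjoint (((Y ×ˢ X).image fun p : A × A => p.1 - p.2).image fun z => z + β)
      (((X ×ˢ Y).image fun p : A × A => p.1 - p.2).image fun z => z + γ))
    (hcover : ((X ×ˢ Y).image fun p : A × A => p.1 + p.2) ∪
      (((Y ×ˢ X).image fun p : A × A => p.1 - p.2).image fun z => z + β) ∪
      (((X ×ˢ Y).image fun p : A × A => p.1 - p.2).image fun z => z + γ) = univ.erase x₀) : False := by
  -- the pulled-back characters `ψ w a = i^⟨w, φ a⟩` as an opaque local function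
  obtain ⟨ψ, hψ⟩ : ∃ ψ : ZMod 4 × ZMod 4 → A → GaussianInt,
      ∀ w a, ψ w a = (⟨0, 1⟩ : GaussianInt) ^ (w.1 * (φ a).1 + w.2 * (φ a).2).val := ⟨_, fun _ _ => rfl⟩
  have hψadd : ∀ w a b, ψ w (a + b) = ψ w a * ψ w b := fun w a b => by
    rw [hψ, hψ, hψ]; exact z4char_add φ w a b
  have hψneg : ∀ w a, ψ w (-a) = star (ψ w a) := fun w a => by rw [hψ, hψ]; exact z4char_neg φ w a
  have hψsum : ∀ w, w ≠ 0 → ∑ a, ψ w a = 0 := fun w hw => by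
    simp only [hψ]; exact z4char_sum_eq_zero φ hφ w hw
  -- the identity `(E_w)` for every `w ≠ 0`
  have E : ∀ w : ZMod 4 × ZMod 4, w ≠ 0 →
      (∑ x ∈ X, ψ w x) * (∑ v ∈ Y, ψ w v) + ψ w β * star (∑ x ∈ X, ψ w x) * (∑ v ∈ Y, ψ w v) +
        ψ w γ * (∑ x ∈ X, ψ w x) * star (∑ v ∈ Y, ψ w v) + ψ w x₀ = 0 := by
    intro w hw
    have h := shifted_form_charsum (ψ w) (hψadd w) hinj hPQ hPR hQR hcover
    rw [hψsum w hw] at h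
    simp only [hψneg] at h
    rw [star_sum, star_sum]
    linear_combination -h
  -- real characters
  have hreal2 : ∀ w : ZMod 4 × ZMod 4, ∀ a, star (ψ (w + w) a) = ψ (w + w) a := fun w a => by
    rw [hψ, z4pair_two, star_ipow_two_mul]
  have hrealS : ∀ (w : ZMod 4 × ZMod 4) (S : Finset A), star (∑ v ∈ S, ψ (w + w) v) = ∑ v ∈ S, ψ (w + w) v :=
    fun w S => by rw [star_sum]; exact sum_congr rfl fun v _ => hreal2 w v
  -- the real characters forbid `(ψβ, ψγ) = (1,1)`
  have R2 : ∀ w : ZMod 4 × ZMod 4, w + w ≠ 0 → ¬ (ψ (w + w) β = 1 ∧ ψ (w + w) γ = 1) := by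
    rintro w hw ⟨h1, h2⟩
    have h := E (w + w) hw
    rw [h1, h2, hrealS, hrealS] at h
    apply three_mul_ne_neg_ipow ((∑ x ∈ X, ψ (w + w) x) * ∑ v ∈ Y, ψ (w + w) v)
      ((w + w).1 * (φ x₀).1 + (w + w).2 * (φ x₀).2)
    rw [← hψ]; linear_combination h
  have e20 : ∀ q : ZMod 4 × ZMod 4, ((1, 0) + (1, 0) : ZMod 4 × ZMod 4).1 * q.1 +
      ((1, 0) + (1, 0) : ZMod 4 × ZMod 4).2 * q.2 = 2 * q.1 + 0 * q.2 := fun q => by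
    simp only [Prod.mk_add_mk]; ring
  have e02 : ∀ q : ZMod 4 × ZMod 4, ((0, 1) + (0, 1) : ZMod 4 × ZMod 4).1 * q.1 +
      ((0, 1) + (0, 1) : ZMod 4 × ZMod 4).2 * q.2 = 0 * q.1 + 2 * q.2 := fun q => by
    simp only [Prod.mk_add_mk]; ring
  have e22 : ∀ q : ZMod 4 × ZMod 4, ((1, 1) + (1, 1) : ZMod 4 × ZMod 4).1 * q.1 +
      ((1, 1) + (1, 1) : ZMod 4 × ZMod 4).2 * q.2 = 2 * q.1 + 2 * q.2 := fun q => by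
    simp only [Prod.mk_add_mk]; ring
  have R2' : ∀ w : ZMod 4 × ZMod 4, w + w ≠ 0 →
      ¬ ((⟨0, 1⟩ : GaussianInt) ^ ((w + w).1 * (φ β).1 + (w + w).2 * (φ β).2).val = 1 ∧
         (⟨0, 1⟩ : GaussianInt) ^ ((w + w).1 * (φ γ).1 + (w + w).2 * (φ γ).2).val = 1) := by
    intro w hw; rw [← hψ, ← hψ]; exact R2 w hw
  obtain ⟨w, w', hwP, hwQ, hw'P, hw'Q⟩ := exists_dual_pair (φ β) (φ γ)
    (by rw [← e20, ← e20]; exact R2' _ (by decide))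
    (by rw [← e02, ← e02]; exact R2' _ (by decide))
    (by rw [← e22, ← e22]; exact R2' _ (by decide))
  -- non-vanishing of the characters used
  have hw0 : w ≠ 0 := by
    rintro rfl
    simp only [Prod.fst_zero, Prod.snd_zero, zero_mul, add_zero] at hwP; exact absurd hwP (by decide)
  have hw'0 : w' ≠ 0 := by
    rintro rfl
    simp only [Prod.fst_zero, Prod.snd_zero, zero_mul, add_zero] at hw'Q; exact absurd hw'Q (by decide)
  have h2w0 : w + w ≠ 0 := by
    intro h
    have := z4pair_two w (φ β)
    rw [h, hwP, mul_one] at this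
    simp only [Prod.fst_zero, Prod.snd_zero, zero_mul, add_zero] at this; exact absurd this (by decide)
  have h2w'0 : w' + w' ≠ 0 := by
    intro h
    have := z4pair_two w' (φ γ)
    rw [h, hw'Q, mul_one] at this
    simp only [Prod.fst_zero, Prod.snd_zero, zero_mul, add_zero] at this; exact absurd this (by decide)
  have h2ww'0 : (w + w') + (w + w') ≠ 0 := by
    intro h
    have := z4pair_two (w + w') (φ β)
    rw [h, z4pair_add_left, hwP, hw'P, add_zero, mul_one] at this
    simp only [Prod.fst_zero, Prod.snd_zero, zero_mul, add_zero] at this; exact absurd this (by decide)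
  have hW₂0 : w + (w' + w') ≠ 0 := by
    intro h
    have := z4pair_add_left w (w' + w') (φ β)
    rw [h, z4pair_two, hwP, hw'P, mul_zero, add_zero] at this
    simp only [Prod.fst_zero, Prod.snd_zero, zero_mul, add_zero] at this; exact absurd this (by decide)
  have hW₂'0 : w' + (w + w) ≠ 0 := by
    intro h
    have := z4pair_add_left w' (w + w) (φ γ)
    rw [h, z4pair_two, hw'Q, hwQ, mul_zero, add_zero] at this
    simp only [Prod.fst_zero, Prod.snd_zero, zero_mul, add_zero] at this; exact absurd this (by decide)
  -- coordinates of the points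
  obtain ⟨m, hm⟩ : ∃ m : A → ZMod 4, ∀ x, m x = w.1 * (φ x).1 + w.2 * (φ x).2 := ⟨_, fun _ => rfl⟩
  obtain ⟨n, hn⟩ : ∃ n : A → ZMod 4, ∀ x, n x = w'.1 * (φ x).1 + w'.2 * (φ x).2 := ⟨_, fun _ => rfl⟩
  have eψ1 : ∀ x, ψ w x = (⟨0, 1⟩ : GaussianInt) ^ (m x).val := fun x => by rw [hψ, hm]
  have eψ2 : ∀ x, ψ (w + (w' + w')) x = (⟨0, 1⟩ : GaussianInt) ^ (m x + 2 * n x).val := fun x => by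
    rw [hψ, z4pair_add_left, z4pair_two, hm, hn]
  have eψ3 : ∀ x, ψ w' x = (⟨0, 1⟩ : GaussianInt) ^ (n x).val := fun x => by rw [hψ, hn]
  have eψ4 : ∀ x, ψ (w' + (w + w)) x = (⟨0, 1⟩ : GaussianInt) ^ (n x + 2 * m x).val := fun x => by
    rw [hψ, z4pair_add_left, z4pair_two, hm, hn]
  have eψ5 : ∀ x, ψ (w + w) x = (⟨0, 1⟩ : GaussianInt) ^ (2 * m x).val := fun x => by rw [hψ, z4pair_two, hm]
  have eψ6 : ∀ x, ψ (w' + w') x = (⟨0, 1⟩ : GaussianInt) ^ (2 * n x).val := fun x => by rw [hψ, z4pair_two, hn]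
  have eψ7 : ∀ x, ψ ((w + w') + (w + w')) x = (⟨0, 1⟩ : GaussianInt) ^ (2 * (m x + n x)).val := fun x => by
    rw [hψ, z4pair_two, z4pair_add_left, hm, hn]
  have hs1 : ∑ x ∈ X, ψ w x = ∑ x ∈ X, (⟨0, 1⟩ : GaussianInt) ^ (m x).val := sum_congr rfl fun x _ => eψ1 x
  have hs2 : ∑ x ∈ X, ψ (w + (w' + w')) x = ∑ x ∈ X, (⟨0, 1⟩ : GaussianInt) ^ (m x + 2 * n x).val :=
    sum_congr rfl fun x _ => eψ2 x
  have hs3 : ∑ x ∈ X, ψ w' x = ∑ x ∈ X, (⟨0, 1⟩ : GaussianInt) ^ (n x).val := sum_congr rfl fun x _ => eψ3 x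
  have hs4 : ∑ x ∈ X, ψ (w' + (w + w)) x = ∑ x ∈ X, (⟨0, 1⟩ : GaussianInt) ^ (n x + 2 * m x).val :=
    sum_congr rfl fun x _ => eψ4 x
  have hs5 : ∑ x ∈ X, ψ (w + w) x = ∑ x ∈ X, (⟨0, 1⟩ : GaussianInt) ^ (2 * m x).val := sum_congr rfl fun x _ => eψ5 x
  have hs6 : ∑ x ∈ X, ψ (w' + w') x = ∑ x ∈ X, (⟨0, 1⟩ : GaussianInt) ^ (2 * n x).val := sum_congr rfl fun x _ => eψ6 x
  have hs7 : ∑ x ∈ X, ψ ((w + w') + (w + w')) x = ∑ x ∈ X, (⟨0, 1⟩ : GaussianInt) ^ (2 * (m x + n x)).val :=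
    sum_congr rfl fun x _ => eψ7 x
  -- pairings of `β, γ` with the four complex characters
  have hW₂P : (w + (w' + w')).1 * (φ β).1 + (w + (w' + w')).2 * (φ β).2 = 1 := by
    rw [z4pair_add_left, z4pair_two, hwP, hw'P, mul_zero, add_zero]
  have hW₂Q : (w + (w' + w')).1 * (φ γ).1 + (w + (w' + w')).2 * (φ γ).2 = 2 := by
    rw [z4pair_add_left, z4pair_two, hwQ, hw'Q, mul_one, zero_add]
  have hW₂'P : (w' + (w + w)).1 * (φ β).1 + (w' + (w + w)).2 * (φ β).2 = 2 := by
    rw [z4pair_add_left, z4pair_two, hw'P, hwP, mul_one, zero_add]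
  have hW₂'Q : (w' + (w + w)).1 * (φ γ).1 + (w' + (w + w)).2 * (φ γ).2 = 1 := by
    rw [z4pair_add_left, z4pair_two, hw'Q, hwQ, mul_zero, add_zero]
  -- (K) the four Pell facts
  have E1 := E w hw0
  rw [hs1, hψ w β, hψ w γ, hwP, hwQ, ipow_zmod_one, ipow_zmod_zero, hψ w x₀] at E1
  have E2 := E (w + (w' + w')) hW₂0
  rw [hs2, hψ _ β, hψ _ γ, hW₂P, hW₂Q, ipow_zmod_one, ipow_zmod_two, hψ _ x₀] at E2
  have E3 := E w' hw'0
  rw [hs3, hψ w' β, hψ w' γ, hw'P, hw'Q, ipow_zmod_zero, ipow_zmod_one, hψ w' x₀] at E3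
  have E4 := E (w' + (w + w)) hW₂'0
  rw [hs4, hψ _ β, hψ _ γ, hW₂'P, hW₂'Q, ipow_zmod_two, ipow_zmod_one, hψ _ x₀] at E4
  -- (C) the eight congruences and (R) the three real sums
  have C1 := congr_L1 X m n
  have C2 := congr_L2 X m n
  have C3 := congr_L3 X m n
  have C4 := congr_L4 X m n
  have C5 := congr_L5 X m n
  have C6 := congr_L6 X m n
  have C7 := congr_L7 X m n
  have C8 := congr_L8 X m n
  have R1 : ((X.filter fun x => 2 * m x = 0 ∧ 2 * n x = 0).card : ℤ) + (X.filter fun x => 2 * m x = 0 ∧ 2 * n x = 2).card -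
      (X.filter fun x => 2 * m x = 2 ∧ 2 * n x = 0).card - (X.filter fun x => 2 * m x = 2 ∧ 2 * n x = 2).card = 1 ∨
      ((X.filter fun x => 2 * m x = 0 ∧ 2 * n x = 0).card : ℤ) + (X.filter fun x => 2 * m x = 0 ∧ 2 * n x = 2).card -
      (X.filter fun x => 2 * m x = 2 ∧ 2 * n x = 0).card - (X.filter fun x => 2 * m x = 2 ∧ 2 * n x = 2).card = -1 := by
    have h := E (w + w) h2w0
    rw [hrealS, hrealS, hs5, real_R1 X m n, hψ (w + w) x₀] at h
    exact int_eq_of_mul_eq_neg_ipow _ ((∑ v ∈ Y, ψ (w + w) v) * (1 + ψ (w + w) β + ψ (w + w) γ)) _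
      (by linear_combination h)
  have R2v : ((X.filter fun x => 2 * m x = 0 ∧ 2 * n x = 0).card : ℤ) - (X.filter fun x => 2 * m x = 0 ∧ 2 * n x = 2).card +
      (X.filter fun x => 2 * m x = 2 ∧ 2 * n x = 0).card - (X.filter fun x => 2 * m x = 2 ∧ 2 * n x = 2).card = 1 ∨
      ((X.filter fun x => 2 * m x = 0 ∧ 2 * n x = 0).card : ℤ) - (X.filter fun x => 2 * m x = 0 ∧ 2 * n x = 2).card +
      (X.filter fun x => 2 * m x = 2 ∧ 2 * n x = 0).card - (X.filter fun x => 2 * m x = 2 ∧ 2 * n x = 2).card = -1 := by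
    have h := E (w' + w') h2w'0
    rw [hrealS, hrealS, hs6, real_R2 X m n, hψ (w' + w') x₀] at h
    exact int_eq_of_mul_eq_neg_ipow _ ((∑ v ∈ Y, ψ (w' + w') v) * (1 + ψ (w' + w') β + ψ (w' + w') γ)) _
      (by linear_combination h)
  have R3 : ((X.filter fun x => 2 * m x = 0 ∧ 2 * n x = 0).card : ℤ) - (X.filter fun x => 2 * m x = 0 ∧ 2 * n x = 2).card -
      (X.filter fun x => 2 * m x = 2 ∧ 2 * n x = 0).card + (X.filter fun x => 2 * m x = 2 ∧ 2 * n x = 2).card = 1 ∨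
      ((X.filter fun x => 2 * m x = 0 ∧ 2 * n x = 0).card : ℤ) - (X.filter fun x => 2 * m x = 0 ∧ 2 * n x = 2).card -
      (X.filter fun x => 2 * m x = 2 ∧ 2 * n x = 0).card + (X.filter fun x => 2 * m x = 2 ∧ 2 * n x = 2).card = -1 := by
    have h := E ((w + w') + (w + w')) h2ww'0
    rw [hrealS, hrealS, hs7, real_R3 X m n, hψ ((w + w') + (w + w')) x₀] at h
    exact int_eq_of_mul_eq_neg_ipow _
      ((∑ v ∈ Y, ψ ((w + w') + (w + w')) v) * (1 + ψ ((w + w') + (w + w')) β + ψ ((w + w') + (w + w')) γ)) _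
      (by linear_combination h)
  -- parities of the four sums, then the Pell facts
  have hodd1 : Odd ((∑ x ∈ X, (⟨0, 1⟩ : GaussianInt) ^ (m x).val).re +
      (∑ x ∈ X, (⟨0, 1⟩ : GaussianInt) ^ (m x).val).im) := Int.odd_iff.2 (by omega)
  have hodd2 : Odd ((∑ x ∈ X, (⟨0, 1⟩ : GaussianInt) ^ (m x + 2 * n x).val).re +
      (∑ x ∈ X, (⟨0, 1⟩ : GaussianInt) ^ (m x + 2 * n x).val).im) := Int.odd_iff.2 (by omega)
  have hodd3 : Odd ((∑ x ∈ X, (⟨0, 1⟩ : GaussianInt) ^ (n x).val).re +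
      (∑ x ∈ X, (⟨0, 1⟩ : GaussianInt) ^ (n x).val).im) := Int.odd_iff.2 (by omega)
  have hodd4 : Odd ((∑ x ∈ X, (⟨0, 1⟩ : GaussianInt) ^ (n x + 2 * m x).val).re +
      (∑ x ∈ X, (⟨0, 1⟩ : GaussianInt) ^ (n x + 2 * m x).val).im) := Int.odd_iff.2 (by omega)
  have K1 := kP_mod_four (v := 1) (b := ∑ v ∈ Y, ψ w v) (l := w.1 * (φ x₀).1 + w.2 * (φ x₀).2) (Or.inl rfl)
    hodd1 (by linear_combination E1)
  have K2 := kP_mod_four (v := -1) (b := ∑ v ∈ Y, ψ (w + (w' + w')) v)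
    (l := (w + (w' + w')).1 * (φ x₀).1 + (w + (w' + w')).2 * (φ x₀).2) (Or.inr rfl) hodd2 (by linear_combination E2)
  have K3 := kPp_mod_four (b := ∑ v ∈ Y, ψ w' v) (l := w'.1 * (φ x₀).1 + w'.2 * (φ x₀).2) hodd3
    (by linear_combination E3)
  have K4 := kPm_mod_four (b := ∑ v ∈ Y, ψ (w' + (w + w)) v)
    (l := (w' + (w + w)).1 * (φ x₀).1 + (w' + (w + w)).2 * (φ x₀).2) hodd4 (by linear_combination E4)
  omega

end Main

end Summit.MatrixMultiplication.OmegaCensus
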